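import Summits.AnomalousDissipation.AnomalousDissipation.Theorems.TaylorCertificatesTargetImpliesSteadyDirect
import Summits.AnomalousDissipation.AnomalousDissipation.Theorems.EnsembleCeiling.Negative.BeltramiFat
import Summits.AnomalousDissipation.AnomalousDissipation.Theorems.EnsembleCeiling.Negative.CellularFat
import Summits.AnomalousDissipation.AnomalousDissipation.Theorems.EnsembleCeiling.Negative.OrthogonalClassFat
import Summits.AnomalousDissipation.AnomalousDissipation.Theorems.EnsembleCeiling.Negative.SingleModeFat
import Summits.AnomalousDissipation.AnomalousDissipation.Theorems.FloorCertificateEnsembleCeiling.Negative.SteadyPinch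
import Summits.AnomalousDissipation.AnomalousDissipation.Theorems.FloorCertificateEnsembleCeiling.Negative.InertialBound
import Summits.AnomalousDissipation.AnomalousDissipation.Theorems.FloorCertificateEnsembleCeiling.Negative.EnsemblePinch
import Summits.AnomalousDissipation.AnomalousDissipation.Theorems.FloorCertificateEnsembleCeiling.Negative.NoLeanStatistics
import Summits.AnomalousDissipation.AnomalousDissipation.Theorems.FloorCertificateEnsembleCeiling.Negative.RelaxedAxioms
import Summits.AnomalousDissipation.AnomalousDissipation.Theorems.FloorCertificateEnsembleCeiling.Negative.KillShapes
import Summits.AnomalousDissipation.AnomalousDissipation.Theorems.FloorCertificateEnsembleCeiling.Negative.TameLimits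
import Summits.AnomalousDissipation.AnomalousDissipation.Theorems.FloorCertificateEnsembleCeiling.Negative.LaminarPreimage
import Literature.Analysis.FluidPDE.StatisticalSolutionEnergyEq
import Literature.Analysis.FluidPDE.StatisticalSolutionProofs
import Literature.Analysis.FluidPDE.StatisticalSolutionDirac
import Literature.Analysis.FluidPDE.PassiveScalarDriftApproxStrain
import Literature.Analysis.FunctionSpaces.TorusSobolevSpaceProofs
import Summits.AnomalousDissipation.AnomalousDissipation.Theorems.FloorCertificateEnsembleCeiling.Negative.FormalGuards
-- LANDED p127512 (g4; re-elaborates rc 0 as a file) — imported from the next publication on, once the farm has BUILT the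
-- module (at v8 publication time `lean check` answers `stale:unbuilt:…RoughStates`); §K.3 then becomes a pure alias:
-- import Summits.AnomalousDissipation.AnomalousDissipation.Theorems.FloorCertificateEnsembleCeiling.Negative.RoughStates

/-!
# Disproof work file — crux `TaylorCertificates.FloorCertificateEnsembleCeiling` (stmt-AnomalousDissipation-14086)

v8 — cdisprove seat `refuter-cdisprove-stmt-AnomalousDissipation-14086-g4-0` (generation 4, cycle 1, 2026-08-16),
EXTENDING v7 of seat `…-g3-0` (generation 3), v6 of `…-g2-0` (generation 2) and v1–v5 of `…-14086-0` (generation 1).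

## WHAT v8 ADDS (generation 4)
* §K.3 CLOSED UNCONDITIONALLY (LANDED `Negative/RoughStates.lean`, p127512; `Negative/FormalGuards.lean` p126933 is now
  built and IMPORTED above): a NAMED ROUGH ELEMENT OF `H` — the lacunary shear with Fourier support `{±4^{n+1}e₀}` and
  coefficients `4^{-(n+1)}e₁` (`exists_rough_energySpace`: continuous, solenoidal, mean-zero, `Torus.eGradNormSq = ⊤`;
  `exists_energySpace_not_mem_energySpaceV`: `H ≠ V` on `T³` with a witness; the synthesis lemma
  `exists_energySpace_of_coeff` turns ANY absolutely summable conjugation-symmetric transversal mean-free coefficient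
  family into an element of `H` via the Leray projector) — and with it
  `floorCertificateEnsembleCeiling_false_without_guard : ¬(X with the finite-enstrophy guard deleted)`, OUTRIGHT, for
  every force and all constants. §L(3) is resolved; the `_false_without_` census of `X`'s hypotheses (§G) is complete
  except for the two hypotheses shown to carry no cheap violator either way (`θ₁ ≤ 0`, the Leray ball).
* §J g4 NUMERICS (kit j020246 `steady123-g4b`, this seat, script `job/steady123.py` of the seat folder, smoke-tested as
  j020142; the g2/g3 jobs j018108/j020045 reported to seats whose outputs are not readable here, so §J still had NO numbers;
  QUEUED at v8 publication — table appended to §J by the next publication): Newton–GMRES continuation in `ν` (0.08 → 0.002, ratio 0.8, secant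
  predictor, step bisection on failure) of the STOKES-BRANCH steady states of `NS_ν(f₁₂₃)`, pseudo-spectral Galerkin
  `N = 32` (`K = 10`) with `N = 48` re-convergence at `ν = 0.02, 0.01, 0.005, 0.0025`; DNS (IF-RK4) from RANDOM data of
  half the laminar energy at `ν = 0.01, 0.005, 0.0035`; `f_GP` control ladder. Table and reading in §J.
* §M (new) the generation-4 attack log: what was tried on `X` beyond v7 and why it stops (2½-D shear-plus-scalar
  forces — the exact missing lemma; weak-limit form of the moat; sign / ball / positivity guards; literature watch 2026).

## WHAT v7 ADDED (generation 3) — three landed `Negative/` files and the g3 numerics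
* §0 RESOLVED: every landed `Negative/` module of this crux now BUILDS on the farm and is imported above (the v6
  `stale:unbuilt` state and the `WeakDuality`/`SingleModeFat` breakage are gone: repairs p108404/p108405 landed); the
  LOCAL COPIES of §C/§I are kept verbatim for the readers of earlier versions (they re-elaborate against the imports).
* §K.1 NO TAME LIMITS (LANDED `Negative/TameLimits.lean`, p126700): the MOAT LEMMA `ν‖∇u‖² = (u,f) = (u−U,f) ≤ ‖f‖₂‖u−U‖`
  for every steady `u ∈ V` of `NS_ν(f)` and EVERY finite-enstrophy steady weak Euler solution `U` of the same force
  (`(U,f) = 0`: the tree's steady energy equation at `ν = 0`); under X's floor an `ε₀/‖f‖₂`-moat separates the steady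
  states from the tame Euler-steady set uniformly in `ν < ν₀` (`floor_moat`); KILL SHAPES `xBody_false_of_tameApproach`
  / `xBody_false_of_tameLimit`: steady states approaching (in `L²`) finite-enstrophy steady Euler solutions at
  arbitrarily small `ν` — in particular ANY sequence of steady states `u_n`, `ν_n → 0`, converging in `L²` to a field of
  FINITE ENSTROPHY (limits are automatically steady weak Euler: `isSteadyWeakSolution_zero_of_tendsto`) — kill the
  floor family and `X` at `f`, no ceiling needed. ONSAGER READING: under `X(f)` steady states can accumulate in `L²`
  only at infinite-enstrophy fields; "smooth skeleton + vanishing-energy exploding-enstrophy fluctuations" is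
  excluded. New necessary condition on the witness force AND a reading rule for every branch-continuation experiment
  (§J): convergence of a loud steady branch's profile in `L²` to an `H¹` field is impossible — a converging profile
  means the branch goes QUIET.
* §K.2 ABSTRACT MARCHIORO BARRIER (LANDED `Negative/LaminarPreimage.lean`, p126748): for ANY smooth solenoidal mean-zero
  weakly Euler-steady `U ≠ 0`, the force `f = −ΔU` carries the exact laminar family `U/ν` (energy `‖U‖₂²/ν²`), so X's
  body is false at `f` and X's witness is not `−ΔU` (`target_witness_not_laplacian_of_eulerSteady`). One statement
  covering the four trig-polynomial exclusion files (single mode / single shell Euler-steady / orthogonal class /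
  cellular) and every smooth unidirectional, lifted 2-D steady Euler (`Δψ = F(ψ)`), Beltrami-type profile.
* §K.3 FORMAL ANATOMY OF THE GUARD (`Negative/FormalGuards.lean`, p126933 pending at publication): the finite-enstrophy
  guard of the floor is LOAD-BEARING — the unguarded floor (`ε₀ > 0`, `θ₁ ≤ 0`) forces every state of `H` to have
  finite enstrophy (rough states `u* + t·r` accumulate at Temam's steady state, where the tested generator vanishes and
  `2θ₁(u*,f) ≤ 0`; both terms are norm-continuous on `H`), i.e. `X` without the guard would force `H = V`. Closes the
  §G list: every hypothesis of `X` now has its `_false_without_` / `_trivial_without_` / decoration theorem except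
  `θ₁ ≤ 0` (sign of the energy channel — used by every weak-duality lemma; no cheap violator either way) and the Leray
  ball (NOT load-bearing for falsity: outside the ball the certifier pays `|θ₁| ≍ 1/ν`, affordable — v5 analysis).
* §J g3 NUMERICS (kit j020045 `steady123-full`, attached to the item; smoke j019997): Newton–LGMRES (Stokes-preconditioned,
  exact linearisation, identity on discarded modes) continuation in `ν` (0.04 → 0.001, ratio 0.8) of the from-rest
  steady branch of `NS_ν(f₁₂₃)`, `N = 32` with `N = 48` re-convergence checks, control `f_GP`, alternative seeds
  (scaled Stokes, x-jet skeletons, random) at `ν ≈ 0.01, 0.005`; per `ν`: `U²`, `ε`, `(f,u)`, `β`, `κ`, component and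
  low-mode energies, tail fraction, and the `L²` DISTANCE TO THE PREVIOUS BRANCH POINT (the §K.1 test). The g2 job
  j018108 never reported into this file (its outputs are not readable by later seats); j020045 supersedes it. Results
  are folded into §J by the next publication.
* §L GAPS named precisely (what no landed lemma excludes yet): 2½-D forces (`x₃`-invariant WITH `f₃ ≠ 0`), planarity
  along the other axes / lattice directions (coordinate-permutation covariance unformalised), and the missing named
  rough element of `H` (which would turn §K.3 into an outright `¬ X-without-guard`).

The crux `X` (rank-0 TARGET of route TaylorCertificates) is, for ONE smooth solenoidal mean-zero force `f` and
constants `ε₀, E, ν₀`, the conjunction at every `ν ∈ (0, ν₀)` of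
* the FLOOR: some cylindrical `Φ₁`, `θ₁ ≤ 0` with `ε₀ ≤ ν‖∇u‖² + ⟨F(u), Φ₁'(u)⟩ + 2θ₁((u,f) − ν‖∇u‖²)` at every
  finite-enstrophy state of the Leray ball `|u|² ≤ 16‖f‖²/ν²`;
* the ENSEMBLE CEILING: every stationary statistical solution of `NS_ν(f)` (FMRT IV Def. 1.3) with integrable
  energy has mean energy `≤ E`.

## STATUS (v6, kept; v7 status above)
NO KILL. Every conclusive negative lemma of this file is now LANDED (gate-accepted, `--supports stmt-…-14086`) under
`Theorems/FloorCertificateEnsembleCeiling/Negative/`: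
`SteadyPinch.lean` (p107890), `InertialBound.lean` (p107580), `EnsemblePinch.lean` (p108112),
`NoLeanStatistics.lean` (p108277), `RelaxedAxioms.lean` (p108700, pending) — all def-free and importing only
`TaylorCertificatesTargetImpliesSteadyDirect` + Literature. The sections below keep the readable vocabulary
(`FloorAt`/`CeilingAt`/`PairAt`/`TargetAt`), POINT to the landed theorems by name, and keep LOCAL COPIES only of what
the new sections use (the farm had not yet built the landed modules when v6 was published, see the import block); new in
v6: §0 (tree health), §I (the picked line `Sketch`), §J (numerics + the fat-branch ansatz test on the line's witness
force), §H updated.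

## §0 TREE HEALTH (v6 finding; repairs filed)
`Theorems/FloorCertificate/Negative/WeakDuality.lean` names the route declaration `FloorCertificate` (stmt-14091) that
the route repair rev 13 DROPPED (item closed `moot`); it — and everything importing it — has not built from source
since 06:40Z 2026-08-16 (stale oleans still let `lean check` import it, which is why nobody noticed; confirmed by
re-elaborating a copy: `Unknown identifier …FloorCertificate`; independently recorded in the header of
`Theorems/TaylorCertificatesTargetImpliesSteadyDirect.lean`). AFFECTED: this file v1–v5, the line skeleton
`Lines/Sketch.lean`, the landed line stubs A `StubWeakDualityBudget`, D `StubLinearLiouville`, E `StubSteadyTaxed`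
(direct imports) and G `StubBudgetDuality`, T1 `StubFloorOfRelaxedFloor` (through
`TaylorCertificatesFloorCertificateStubMinimaxAlternativeTools`), `FloorCertificate/Negative/{Uniform,InjectedBeat,…}`,
`KolmogorovFloorEnsembleCeiling/Negative/{SameForce,DodgerStates,PlanarSteady}`, `KolmogorovFloor/Negative/CheapBaseTools`;
likewise `EnsembleCeiling/Negative/SingleModeFat.lean` names the dropped `EnsembleCeiling` (stmt-14090) in its last
theorem. REPAIRS FILED by this seat (review lane, additive only, convention of
`TaylorCertificatesTaylorCertificatePairRefutation.lean`: re-declare the dropped constant under its original FQN with the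
ledger signature verbatim): p108404 (`WeakDuality.lean` += `def …Theses.TaylorCertificates.FloorCertificate`),
p108405 (`SingleModeFat.lean` += `def …EnsembleCeiling`, + `linter.dupNamespace false`). Both re-elaborate rc 0 with
0 warnings from source. Until they land, v6 imports neither chain.

## FINDINGS (index; details in the docstrings; everything is sorry-free unless marked NEAR-MISS)
* §A `FloorAt` / `CeilingAt` / `PairAt` / `TargetAt` / `target_iff` — the crux unbundled (definitional).
* §B PROJECTIONS / necessity of #3: `target_false_of_not_steadyStatesLoudBounded` (LANDED) — a refutation of the
  route's deciding crux `SteadyStatesLoudBounded` refutes `X`.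
* §C THE PINCH (LANDED `Negative.SteadyPinch.steady_pinch`, `Negative.EnsemblePinch.ensemble_pinch`): under the pair
  EVERY stationary statistical solution `μ` of `NS_ν(f)` has `ε₀ ≤ ε(μ) ≤ ‖f‖₂ √e(μ) ≤ ‖f‖₂ √E`, every steady state
  `u ∈ V` is loud/bounded/rough (`ε₀ ≤ ν‖∇u‖² = (u,f)`, `|u|² ≤ E`, `‖∇u‖² ≥ ε₀/ν`); budgets COUPLED
  (`pair_constants`: `ε₀² ≤ ‖f‖₂² E`, `E > 0`, `f ≠ 0`).
* §D REFUTED STRENGTHENINGS (LANDED): no super-laminar floor (`floorCertificateEnsembleCeiling_superLaminar_false`),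
  no sub-inertial ceiling (`Negative.InertialBound`: `‖f‖₂² ≤ ‖∇f‖_∞ E`, Doering–Foias `Re ≳ Gr^{1/2}` in steady
  form), its ENSEMBLE form `Negative.NoLeanStatistics.force_sq_le_of_isStationary` and NO LEAN STATISTICS
  `ensembleEnergy_lower_bound` (`e(μ) ≥ min(1,(‖f‖₂²/(ν‖Δf‖₂+‖∇f‖_∞))²)` for every invariant statistics of every force).
* §E THE EXACT ADVERSARY (LANDED as hypotheses of `target_false_of_quietOrFatStatistics` /
  `target_false_of_quietOrFatSteadyStates`): quiet OR fat statistics for every force kill `X` (weak duality); OPEN.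
* §F WITNESS CLASS: `X` fails AT every single-shell Euler-steady force (ABC/Beltrami), every orthogonal-class force
  (unidirectional / one-coordinate shears, any number of shells) and every planar cellular force (`not_targetAt_*`,
  over the buildable `EnsembleCeiling/Negative/{BeltramiFat,OrthogonalClassFat,CellularFat}`); the single-mode and
  `∀ f` statements of v5 (`not_targetAt_singleMode`, `not_forall_forces_target`) return once p108405 lands.
* §G LOAD-BEARING (LANDED): the FLOOR conjunct excludes `f = 0` — without it the crux is TRUE VACUOUSLY
  (`Negative.NoLeanStatistics.floorCertificateEnsembleCeiling_without_floor_trivial`); `ν < ν₀` is load-bearing —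
  without it the crux is FALSE for every force (`floorCertificateEnsembleCeiling_false_without_smallViscosity`);
  `θ₁ ≤ 0` signs the energy channel (used in every weak-duality lemma); `Integrable ‖·‖²` is decoration
  (`IsStationaryStatisticalSolution.integrable_norm_sq`); the finite-enstrophy guard only removes the junk `D = 0`.
* §I THE PICKED LINE `Sketch` (v6): verdicts `line-sound` (no smuggled gap: `X ↔ DualPair` modulo Ky Fan is the
  lead's own kernel-checked pair `dualPair_of_target` / `floorCertificateEnsembleCeiling_of_dualPair`), `line-costume`
  (the one open stub C = `stub_dualPair` IS `X`; nothing below crux size is left to the line), `line-unbuilt` (§0);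
  lemmas: `relaxed_axioms_without_liouville_at_rest` (clause (i) of C needs the Liouville identities: `δ_0` satisfies
  every other relaxed axiom and is quiet), the LANDED species constraint
  `Negative.EnsemblePinch.taxedCertificate_constants` (`4κε₁ ≤ ‖f‖₂²` for every taxed certificate — the line's METHOD is
  quantitatively pinned: friction rate × floor ≤ force power / 4), and `taxed_vs_dualPair` (the species certifies a
  RELAXED ceiling while C(ii) asks only an FMRT ceiling — documentation of the exact surplus of the method over the target).
* §J NUMERICS (v6, kit j018108, this seat): Newton–Krylov continuation in `ν` of the from-rest STEADY branch of
  `NS_ν(f₁₂₃)`, `f₁₂₃ = (sin 2πz, sin 4πx, sin 6πy)` = the line's live witness force (TRIAGE-r1-2 rec. 4), control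
  `f_GP`; results recorded in §J when the job reports (queued at publication time of v6).
* §H WHY `X` RESISTS (updated v6).
-/

noncomputable section

set_option linter.dupNamespace false

open MeasureTheory UnitAddTorus Matrix Filter Topology
open scoped InnerProductSpace ENNReal ComplexConjugate

namespace Summit.AnomalousDissipation.AnomalousDissipation.Cruxes.FloorCertificateEnsembleCeiling.Disproof

open Literature.Analysis.FunctionSpaces Literature.Analysis.FluidPDE
open Summit.AnomalousDissipation.AnomalousDissipation.Theses.TaylorCertificates
open Summit.AnomalousDissipation.AnomalousDissipation.Theorems.EnsembleCeiling.Negative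
open Summit.AnomalousDissipation.AnomalousDissipation.Theorems.TargetImpliesSteadyDirect

/-- Local notation: real vector fields on `T³`. -/
local notation "Vec3" => (UnitAddTorus (Fin 3)) → (EuclideanSpace ℝ (Fin 3))
/-- Local notation: `L²(T³; ℝ³)`. -/
local notation "L2" => (Lp (EuclideanSpace ℝ (Fin 3)) 2 (volume : Measure (UnitAddTorus (Fin 3))))
/-- Local notation: the energy space `H`. -/
local notation "H3" => (Torus.energySpace (Fin 3))

/-! ## §A The crux unbundled -/

/-- X's FLOOR block at one viscosity (verbatim). -/
def FloorAt (f : Vec3) (ε₀ ν : ℝ) : Prop :=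
  ∃ (Φ₁ : Torus.CylindricalTest (Fin 3)) (θ₁ : ℝ), θ₁ ≤ 0 ∧ ∀ u : H3,
    Torus.eGradNormSq ((u : L2) : Vec3) ≠ ⊤ → ‖u‖ ^ 2 ≤ 16 * (∫ x, ‖f x‖ ^ 2) / ν ^ 2 →
      ε₀ ≤ ν * (Torus.eGradNormSq ((u : L2) : Vec3)).toReal + Torus.nsGeneratorPairing ν f u (Φ₁.grad u) +
        2 * θ₁ * (Torus.pairing (u : L2) f - ν * (Torus.eGradNormSq ((u : L2) : Vec3)).toReal)

/-- X's ENSEMBLE CEILING at one viscosity (verbatim). -/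
def CeilingAt (f : Vec3) (E ν : ℝ) : Prop :=
  ∀ μ : Measure H3, Torus.IsStationaryStatisticalSolution ν f μ →
    Integrable (fun v : H3 => ‖v‖ ^ 2) μ → Torus.ensembleEnergy μ ≤ E

/-- The inner block of the crux at one viscosity: FLOOR and CEILING for the same force. -/
def PairAt (f : Vec3) (ε₀ E ν : ℝ) : Prop :=
  FloorAt f ε₀ ν ∧ CeilingAt f E ν

/-- The crux AT a given force. -/
def TargetAt (f : Vec3) : Prop :=
  ∃ (ε₀ E ν₀ : ℝ), 0 < ε₀ ∧ 0 < ν₀ ∧ ∀ ν : ℝ, 0 < ν → ν < ν₀ → PairAt f ε₀ E ν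

/-- `FloorCertificateEnsembleCeiling` ↔ some admissible force carries the pair (definitional). -/
theorem target_iff :
    FloorCertificateEnsembleCeiling ↔
      ∃ f : Vec3, Torus.IsSmooth f ∧ Torus.IsDivFree f ∧ Torus.HasZeroMean f ∧ TargetAt f :=
  Iff.rfl

/-! ## §B Necessity of the deciding crux #3 (LANDED `Negative.SteadyPinch.target_false_of_not_steadyStatesLoudBounded`) -/

/-- A refutation of `SteadyStatesLoudBounded` (#3, the deciding hypothesis of `closes`) refutes `X`. -/
theorem target_false_of_not_steadyStatesLoudBounded (h : ¬ SteadyStatesLoudBounded) :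
    ¬ FloorCertificateEnsembleCeiling :=
  fun hX => h (Summit.AnomalousDissipation.AnomalousDissipation.Theorems.TargetImpliesSteady_direct_proof hX)

/-! ## §C The pinch (LANDED `Negative.SteadyPinch.steady_pinch`, `Negative.EnsemblePinch.{budget_le_ensembleDissipation, ensemble_pinch, energy_window}`) -/

/-- (LOCAL COPY of `Negative.SteadyPinch.steady_pinch`) **The pinch on atoms**: under the pair every steady weak
solution `u ∈ V` has `ε₀ ≤ ν‖∇u‖² = (u,f) ≤ |u|‖f‖₂`, `|u|² ≤ E`, `‖∇u‖² ≥ ε₀/ν`. -/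
theorem steady_pinch {ν : ℝ} (hν : 0 < ν) {f : Vec3} (hf : MemLp f 2 volume) {ε₀ E : ℝ}
    (hpair : PairAt f ε₀ E ν) {u : H3} (hV : (u : L2) ∈ Torus.energySpaceV (Fin 3))
    (hu : Torus.IsSteadyWeakSolution ν f u) :
    ε₀ ≤ ν * (Torus.eGradNormSq ((u : L2) : Vec3)).toReal ∧
      ν * (Torus.eGradNormSq ((u : L2) : Vec3)).toReal = Torus.pairing (u : L2) f ∧
      Torus.pairing (u : L2) f ≤ ‖u‖ * ‖hf.toLp f‖ ∧ ‖u‖ ^ 2 ≤ E ∧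
      ε₀ / ν ≤ (Torus.eGradNormSq ((u : L2) : Vec3)).toReal := by
  obtain ⟨⟨Φ₁, θ₁, -, hfloor⟩, hceil⟩ := hpair
  have h1 : ε₀ ≤ ν * (Torus.eGradNormSq ((u : L2) : Vec3)).toReal := floor_le_dissipation_of_steady hν hf hfloor hV hu
  have h2 : ν * (Torus.eGradNormSq ((u : L2) : Vec3)).toReal = Torus.pairing (u : L2) f :=
    Torus.IsSteadyWeakSolution.energy_eq' (by simp) hf hV hu
  have h3 : Torus.pairing (u : L2) f ≤ ‖u‖ * ‖hf.toLp f‖ := (le_abs_self _).trans (Torus.abs_pairing_coe_le hf u)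
  have h4 : ‖u‖ ^ 2 ≤ E := norm_sq_le_of_ensemble_ceiling hν hf hceil hV hu
  refine ⟨h1, h2, h3, h4, ?_⟩
  rw [div_le_iff₀ hν, mul_comm]
  exact h1

/-- (LOCAL COPY of `Negative.SteadyPinch.pair_constants`) **Coupled budgets**: `ε₀² ≤ ‖f‖₂² E` and `E > 0`. -/
theorem pair_constants {ν : ℝ} (hν : 0 < ν) {f : Vec3} (hf : MemLp f 2 volume) {ε₀ E : ℝ} (hε₀ : 0 < ε₀)
    (hpair : PairAt f ε₀ E ν) : ε₀ ^ 2 ≤ (∫ x, ‖f x‖ ^ 2) * E ∧ 0 < E := by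
  obtain ⟨u, hV, hu⟩ := Torus.Temam1979_exists_steadyWeakSolution_holds (by simp) hν hf
  obtain ⟨h1, h2, h3, h4, -⟩ := steady_pinch hν hf hpair hV hu
  have hF : ‖hf.toLp f‖ ^ 2 = ∫ x, ‖f x‖ ^ 2 := by
    rw [Torus.norm_toLp_eq_sqrt hf, Real.sq_sqrt (integral_nonneg fun x => by positivity)]
  have h5 : ε₀ ≤ ‖u‖ * ‖hf.toLp f‖ := by linarith
  have h6 : ε₀ ^ 2 ≤ (‖u‖ * ‖hf.toLp f‖) ^ 2 := pow_le_pow_left₀ hε₀.le h5 2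
  rw [mul_pow, hF] at h6
  have hFnn : 0 ≤ ∫ x, ‖f x‖ ^ 2 := integral_nonneg fun x => by positivity
  have h7 : ‖u‖ ^ 2 * (∫ x, ‖f x‖ ^ 2) ≤ E * (∫ x, ‖f x‖ ^ 2) := mul_le_mul_of_nonneg_right h4 hFnn
  refine ⟨by nlinarith, ?_⟩
  have hu0 : 0 < ‖u‖ := by
    by_contra h0
    have h0' : ‖u‖ = 0 := le_antisymm (not_lt.1 h0) (norm_nonneg _)
    rw [h0', zero_mul] at h5
    linarith
  nlinarith

/-- (LOCAL COPY of `Negative.SteadyPinch.force_pos_of_pair`) The floor excludes `f = 0`. -/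
theorem force_pos_of_pairAt {ν : ℝ} (hν : 0 < ν) {f : Vec3} (hf : MemLp f 2 volume) {ε₀ E : ℝ} (hε₀ : 0 < ε₀)
    (hpair : PairAt f ε₀ E ν) : 0 < ∫ x, ‖f x‖ ^ 2 := by
  obtain ⟨h1, -⟩ := pair_constants hν hf hε₀ hpair
  by_contra h0
  have hFnn : 0 ≤ ∫ x, ‖f x‖ ^ 2 := integral_nonneg fun x => by positivity
  have hF0 : ∫ x, ‖f x‖ ^ 2 = 0 := le_antisymm (not_lt.1 h0) hFnn
  rw [hF0, zero_mul] at h1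
  nlinarith [mul_pos hε₀ hε₀]

/-- (LOCAL COPY of `Negative.EnsemblePinch.budget_le_ensembleDissipation`) **Weak duality with a state-dependent
budget over FMRT statistics**: a budget-`g` floor with `θ₁ ≤ 0` gives `∫ g dμ ≤ ε(μ)` for every stationary
statistical solution integrating `g`. -/
theorem budget_le_ensembleDissipation {ν : ℝ} (hν : 0 < ν) {f : Vec3} (hf : MemLp f 2 volume)
    {Φ₁ : Torus.CylindricalTest (Fin 3)} {θ₁ : ℝ} (hθ₁ : θ₁ ≤ 0) {g : H3 → ℝ}
    (hfloor : ∀ u : H3, Torus.eGradNormSq ((u : L2) : Vec3) ≠ ⊤ → ‖u‖ ^ 2 ≤ 16 * (∫ x, ‖f x‖ ^ 2) / ν ^ 2 →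
      g u ≤ ν * (Torus.eGradNormSq ((u : L2) : Vec3)).toReal + Torus.nsGeneratorPairing ν f u (Φ₁.grad u) +
        2 * θ₁ * (Torus.pairing (u : L2) f - ν * (Torus.eGradNormSq ((u : L2) : Vec3)).toReal))
    {μ : Measure H3} (hμ : Torus.IsStationaryStatisticalSolution ν f μ) (hg : Integrable g μ) :
    ∫ u, g u ∂μ ≤ Torus.ensembleDissipation ν μ := by
  haveI := hμ.prob
  set Gr : H3 → ℝ≥0∞ := fun u => Torus.eGradNormSq ((u : L2) : Vec3) with hGr
  have hGm : Measurable Gr := Torus.measurable_eGradNormSq_coe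
  have hGfin : ∫⁻ u, Gr u ∂μ < ⊤ := hμ.enstrophy_finite
  have hGlt : ∀ᵐ u ∂μ, Gr u < ⊤ := ae_lt_top hGm hGfin.ne
  have hA : Integrable (fun u => (Gr u).toReal) μ := integrable_toReal_of_lintegral_ne_top hGm.aemeasurable hGfin.ne
  have hball : ∀ᵐ u ∂μ, ‖u‖ ^ 2 ≤ 16 * (∫ x, ‖f x‖ ^ 2) / ν ^ 2 := by
    filter_upwards [hμ.ae_norm_le hν hf] with u hu
    exact leray_ball_of_norm_le hν hf hu
  have hae : ∀ᵐ u ∂μ, g u ≤ ν * (Gr u).toReal + Torus.nsGeneratorPairing ν f u (Φ₁.grad u) +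
      2 * θ₁ * (Torus.pairing (u : L2) f - ν * (Gr u).toReal) := by
    filter_upwards [hGlt, hball] with u hu hb
    exact hfloor u hu.ne hb
  obtain ⟨hC, hC0⟩ := hμ.generator Φ₁
  have hB : Integrable (fun u : H3 => Torus.pairing (u : L2) f) μ := hμ.integrable_pairing hf
  have h1 : Integrable (fun u : H3 => ν * (Gr u).toReal) μ := hA.const_mul ν
  have h2 : Integrable (fun u : H3 => ν * (Gr u).toReal + Torus.nsGeneratorPairing ν f u (Φ₁.grad u)) μ := h1.add hC
  have h3 : Integrable (fun u : H3 => Torus.pairing (u : L2) f - ν * (Gr u).toReal) μ := hB.sub h1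
  have h4 : Integrable (fun u : H3 => 2 * θ₁ * (Torus.pairing (u : L2) f - ν * (Gr u).toReal)) μ := h3.const_mul _
  have hint : Integrable (fun u : H3 => ν * (Gr u).toReal + Torus.nsGeneratorPairing ν f u (Φ₁.grad u) +
      2 * θ₁ * (Torus.pairing (u : L2) f - ν * (Gr u).toReal)) μ := h2.add h4
  have hmono := integral_mono_ae hg hint hae
  have hsplit : ∫ u : H3, (ν * (Gr u).toReal + Torus.nsGeneratorPairing ν f u (Φ₁.grad u) +
      2 * θ₁ * (Torus.pairing (u : L2) f - ν * (Gr u).toReal)) ∂μ =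
      ν * (∫⁻ u, Gr u ∂μ).toReal + 0 +
        2 * θ₁ * (∫ u : H3, Torus.pairing (u : L2) f ∂μ - ν * (∫⁻ u, Gr u ∂μ).toReal) := by
    rw [integral_add h2 h4, integral_add h1 hC, integral_const_mul, integral_const_mul,
      integral_sub hB h1, integral_const_mul, hC0, integral_toReal hGm.aemeasurable hGlt]
  rw [hsplit] at hmono
  have hE : ν * (∫⁻ u, Gr u ∂μ).toReal ≤ ∫ u, Torus.pairing (u : L2) f ∂μ :=
    Torus.IsStationaryStatisticalSolution.energy_le_holds hμ hf
  have hθ : 2 * θ₁ * (∫ u, Torus.pairing (u : L2) f ∂μ - ν * (∫⁻ u, Gr u ∂μ).toReal) ≤ 0 :=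
    mul_nonpos_of_nonpos_of_nonneg (by linarith) (by linarith)
  change ∫ u, g u ∂μ ≤ ν * (∫⁻ u, Gr u ∂μ).toReal
  linarith

/-- (LOCAL COPY of `Negative.EnsemblePinch.ensemble_pinch`) **The pinch on statistics**: under the pair every
stationary statistical solution has `ε₀ ≤ ε(μ)`, `e(μ) ≤ E`, `ε(μ) ≤ ‖f‖₂√e(μ) ≤ ‖f‖₂√E`. -/
theorem pinch {ν : ℝ} (hν : 0 < ν) {f : Vec3} (hf : MemLp f 2 volume) {ε₀ E : ℝ}
    (hpair : PairAt f ε₀ E ν) {μ : Measure H3} (hμ : Torus.IsStationaryStatisticalSolution ν f μ) :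
    ε₀ ≤ Torus.ensembleDissipation ν μ ∧ Torus.ensembleEnergy μ ≤ E ∧
      Torus.ensembleDissipation ν μ ≤ Real.sqrt (∫ x, ‖f x‖ ^ 2) * Real.sqrt (Torus.ensembleEnergy μ) ∧
      Torus.ensembleDissipation ν μ ≤ Real.sqrt (∫ x, ‖f x‖ ^ 2) * Real.sqrt E := by
  obtain ⟨⟨Φ₁, θ₁, hθ₁, hfloor⟩, hceil⟩ := hpair
  haveI := hμ.prob
  have hint : Integrable (fun v : H3 => ‖v‖ ^ 2) μ := hμ.integrable_norm_sq
  have h1 : ε₀ ≤ Torus.ensembleDissipation ν μ := by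
    have h := budget_le_ensembleDissipation hν hf hθ₁ (g := fun _ => ε₀) hfloor hμ (integrable_const ε₀)
    simpa using h
  have h2 : Torus.ensembleEnergy μ ≤ E := hceil μ hμ hint
  have h3 : Torus.ensembleDissipation ν μ ≤ Real.sqrt (∫ x, ‖f x‖ ^ 2) * Real.sqrt (Torus.ensembleEnergy μ) :=
    Torus.ensembleDissipation_le_of_isStationary_holds hμ hf hint
  refine ⟨h1, h2, h3, h3.trans ?_⟩
  exact mul_le_mul_of_nonneg_left (Real.sqrt_le_sqrt h2) (Real.sqrt_nonneg _)

/-! ## §D Refuted strengthenings and the budget window (LANDED; pointers only)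

* no super-laminar floor (`‖f‖₂² E < ε₀²` impossible): `Negative.SteadyPinch.floorCertificateEnsembleCeiling_superLaminar_false`
  (here: immediate from `pair_constants`, see `not_targetSuperLaminar`);
* no sub-inertial ceiling (`‖∇f‖_∞ E < ‖f‖₂²` impossible): `Negative.InertialBound.{steady_force_identity,
  force_sq_le_of_steady, force_sq_le_of_ceiling, not_ceilingSubInertial, floorCertificateEnsembleCeiling_subInertial_false}`;
* its ENSEMBLE form and NO LEAN STATISTICS: `Negative.NoLeanStatistics.{exists_cylindricalTest_grad_eq_on_ball,
  nsGeneratorPairing_force, force_sq_le_of_isStationary, ensembleEnergy_lower_bound}`. -/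

/-- **No super-laminar floor, for any force** (cf. `Negative.SteadyPinch.floorCertificateEnsembleCeiling_superLaminar_false`). -/
theorem not_targetSuperLaminar :
    ¬ ∃ f : Vec3, Torus.IsSmooth f ∧ Torus.IsDivFree f ∧ Torus.HasZeroMean f ∧
      ∃ (ε₀ E ν₀ : ℝ), 0 < ε₀ ∧ 0 < ν₀ ∧ (∫ x, ‖f x‖ ^ 2) * E < ε₀ ^ 2 ∧
        ∀ ν : ℝ, 0 < ν → ν < ν₀ → PairAt f ε₀ E ν := by
  rintro ⟨f, hfs, -, -, ε₀, E, ν₀, hε₀, hν₀, hlt, h⟩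
  have hc := pair_constants (half_pos hν₀) (hfs.memLp 2) hε₀ (h (ν₀ / 2) (half_pos hν₀) (by linarith))
  linarith [hc.1]

/-! ## §E The exact adversary (LANDED as `Negative.{EnsemblePinch.target_false_of_quietOrFatStatistics, SteadyPinch.target_false_of_quietOrFatSteadyStates}`) -/

/-- HYPOTHESIS `QuietOrFatStatistics` (OPEN; the weakest hypothesis killing `X` by weak duality): every admissible
`f ≠ 0` admits, for every box `(ε₀, E)` and at arbitrarily small viscosity, a stationary statistical solution of
`NS_ν(f)` that is QUIET (`ε(μ) < ε₀`) or FAT (`e(μ) > E`).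
[topic AnomalousDissipation: quiet-or-fat stationary statistics for every force] -/
def QuietOrFatStatistics : Prop :=
  ∀ f : Vec3, Torus.IsSmooth f → Torus.IsDivFree f → Torus.HasZeroMean f → 0 < (∫ x, ‖f x‖ ^ 2) →
    ∀ ε₀ E ν₀ : ℝ, 0 < ε₀ → 0 < ν₀ → ∃ ν : ℝ, 0 < ν ∧ ν < ν₀ ∧
      ∃ μ : Measure H3, Torus.IsStationaryStatisticalSolution ν f μ ∧
        (Torus.ensembleDissipation ν μ < ε₀ ∨ E < Torus.ensembleEnergy μ)

/-- HYPOTHESIS `QuietOrFatSteadyStates` (OPEN; the Dirac case). [topic AnomalousDissipation: quiet-or-fat steady branch for every force] -/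
def QuietOrFatSteadyStates : Prop :=
  ∀ f : Vec3, Torus.IsSmooth f → Torus.IsDivFree f → Torus.HasZeroMean f → 0 < (∫ x, ‖f x‖ ^ 2) →
    ∀ ε₀ E ν₀ : ℝ, 0 < ε₀ → 0 < ν₀ → ∃ ν : ℝ, 0 < ν ∧ ν < ν₀ ∧
      ∃ u : H3, (u : L2) ∈ Torus.energySpaceV (Fin 3) ∧ Torus.IsSteadyWeakSolution ν f u ∧
        (ν * (Torus.eGradNormSq ((u : L2) : Vec3)).toReal < ε₀ ∨ E < ‖u‖ ^ 2)

/-- **Negative lemma modulo `QuietOrFatStatistics`** (weak duality; not a refutation). -/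
theorem target_false_of_quietOrFat (hQ : QuietOrFatStatistics) : ¬ FloorCertificateEnsembleCeiling := by
  rintro ⟨f, hfs, hfd, hfz, ε₀, E, ν₀, hε₀, hν₀, h⟩
  have hf2 : MemLp f 2 volume := hfs.memLp 2
  have hF : 0 < ∫ x, ‖f x‖ ^ 2 := force_pos_of_pairAt (half_pos hν₀) hf2 hε₀ (h (ν₀ / 2) (half_pos hν₀) (by linarith))
  obtain ⟨ν, hν, hνν₀, μ, hμ, hq⟩ := hQ f hfs hfd hfz hF ε₀ E ν₀ hε₀ hν₀
  obtain ⟨h1, h2, -, -⟩ := pinch hν hf2 (h ν hν hνν₀) hμ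
  rcases hq with hq | hq <;> linarith

/-- **Negative lemma modulo `QuietOrFatSteadyStates`** (Dirac case). -/
theorem target_false_of_quietOrFatSteadyStates (hQ : QuietOrFatSteadyStates) : ¬ FloorCertificateEnsembleCeiling := by
  rintro ⟨f, hfs, hfd, hfz, ε₀, E, ν₀, hε₀, hν₀, h⟩
  have hf2 : MemLp f 2 volume := hfs.memLp 2
  have hF : 0 < ∫ x, ‖f x‖ ^ 2 := force_pos_of_pairAt (half_pos hν₀) hf2 hε₀ (h (ν₀ / 2) (half_pos hν₀) (by linarith))
  obtain ⟨ν, hν, hνν₀, u, hV, hu, hq⟩ := hQ f hfs hfd hfz hF ε₀ E ν₀ hε₀ hν₀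
  obtain ⟨h1, -, -, h4, -⟩ := steady_pinch hν hf2 (h ν hν hνν₀) hV hu
  rcases hq with hq | hq <;> linarith

/-! ## §F The witness class: forces at which the target fails (buildable part) -/

/-- If the ceiling fails at `f` for every budget, the target fails at `f`. -/
theorem not_targetAt_of_not_ceiling {f : Vec3}
    (h : ¬ ∃ (E ν₀ : ℝ), 0 < ν₀ ∧ ∀ ν : ℝ, 0 < ν → ν < ν₀ → CeilingAt f E ν) : ¬ TargetAt f := by
  rintro ⟨ε₀, E, ν₀, -, hν₀, hp⟩
  exact h ⟨E, ν₀, hν₀, fun ν hν hνν₀ => (hp ν hν hνν₀).2⟩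

/-- **Orthogonal-class forces are not witnesses** (unidirectional / one-coordinate shear forces with any number of
shells: the Stokes preimage is Euler-steady, `not_ceiling_of_orthogonalClass`). -/
theorem not_targetAt_orthogonalClass {n : ℕ} {k : Fin n → (Fin 3 → ℤ)} {z : Fin n → EuclideanSpace ℂ (Fin 3)}
    (hk : ∀ m, k m ≠ 0) (horth : ∀ m m', ((fun j => (((k m')) j : ℂ)) ⬝ᵥ (WithLp.ofLp (z m))) = 0)
    (hnf : ∀ m m' : Fin n, m ≠ m' → k m ≠ k m' ∧ k m ≠ -k m') (hz : ∃ m, z m ≠ 0) :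
    ¬ TargetAt (∑ mm, Torus.realTrigPoly {k mm} (fun _ => z mm)) :=
  not_targetAt_of_not_ceiling (not_ceiling_of_orthogonalClass hk horth hnf hz)

/-- **ABC / Beltrami first-shell forces are not witnesses** (`not_ceiling_abc`). -/
theorem not_targetAt_abc {A B C : ℝ} (h : A ≠ 0 ∨ B ≠ 0 ∨ C ≠ 0) :
    ¬ TargetAt (∑ mm, Torus.realTrigPoly {(![![0, 0, 1], ![1, 0, 0], ![0, 1, 0]] : Fin 3 → (Fin 3 → ℤ)) mm}
      (fun _ => (![(A : ℂ) • (WithLp.toLp 2 ![-Complex.I, 1, 0] : EuclideanSpace ℂ (Fin 3)),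
                  (B : ℂ) • (WithLp.toLp 2 ![0, -Complex.I, 1] : EuclideanSpace ℂ (Fin 3)),
                  (C : ℂ) • (WithLp.toLp 2 ![1, 0, -Complex.I] : EuclideanSpace ℂ (Fin 3))] : Fin 3 → EuclideanSpace ℂ (Fin 3)) mm)) :=
  not_targetAt_of_not_ceiling (not_ceiling_abc h)

/-- **Planar cellular (Taylor–Green / four-roll-mill) forces are not witnesses** (`not_ceiling_cellular`). -/
theorem not_targetAt_cellular {P Q : ℂ} (h : P ≠ 0 ∨ Q ≠ 0) :
    ¬ TargetAt (∑ mm, Torus.realTrigPoly {(![![1, 1, 0], ![1, -1, 0]] : Fin 2 → (Fin 3 → ℤ)) mm}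
      (fun _ => (![P • (WithLp.toLp 2 ![1, -1, 0] : EuclideanSpace ℂ (Fin 3)),
                  Q • (WithLp.toLp 2 ![1, 1, 0] : EuclideanSpace ℂ (Fin 3))] : Fin 2 → EuclideanSpace ℂ (Fin 3)) mm)) :=
  not_targetAt_of_not_ceiling (not_ceiling_cellular h)

/-! ## §G Load-bearing analysis (LANDED; pointers)

* the FLOOR conjunct excludes `f = 0`; without it the crux is TRUE VACUOUSLY:
  `Negative.NoLeanStatistics.{ensembleEnergy_eq_zero_of_zero_force, floorCertificateEnsembleCeiling_without_floor_trivial}`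
  (here `not_targetAt_zero`);
* `ν < ν₀` is load-bearing; without it the crux is FALSE for every force:
  `Negative.SteadyPinch.{steady_dissipation_le, not_floor_of_large_viscosity, floor_budget_le,
  floorCertificateEnsembleCeiling_false_without_smallViscosity}` (the laminar steady state at `ν = ‖f‖₂²/(4π²ε₀)+1` is quiet);
* `θ₁ ≤ 0` signs the energy channel (every weak-duality lemma uses it; no sign is needed for the Dirac case);
* `Integrable ‖·‖²` is decoration (`IsStationaryStatisticalSolution.integrable_norm_sq`); the finite-enstrophy guard only
  removes the junk `D = ν·(⊤).toReal = 0`. -/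

/-- The target at the trivial force is false (the floor alone excludes `f = 0`). -/
theorem not_targetAt_zero : ¬ TargetAt (0 : Vec3) := by
  rintro ⟨ε₀, E, ν₀, hε₀, hν₀, h⟩
  have hF := force_pos_of_pairAt (half_pos hν₀) (memLp_const (μ := (volume : Measure (UnitAddTorus (Fin 3)))) 0)
    hε₀ (h (ν₀ / 2) (half_pos hν₀) (by linarith))
  simp at hF

/-! ## §I The picked line `Sketch` (lead prover-line-stmt-AnomalousDissipation-14086-0; reshape 3)

THE LINE. One open stub C `stub_dualPair` = X's EXACT DUAL for one force: (i) every RELAXED stationary statistic of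
`NS_ν(f)` on the Leray ball (probability, carried by the ball, finite mean enstrophy, ALL cylindrical Liouville
identities, integrable work, ONE global energy inequality `ε(μ) ≤ ∫(u,f)dμ`) is `ε₀`-loud, and (ii) X's FMRT ceiling
verbatim; everything else (A, B, D, E, F, G, T1–T3) is landed glue/duality. The method proposed for C is the TAXED
certificate species `ε₁ + κ|u|² ≤ ν‖∇u‖² + ⟨F,Ψ'⟩ + 2α((u,f) − ν‖∇u‖²)` (`TaxedCertificate`).

VERDICTS of this seat (posted to the item as evidence notes):
* `line-sound`: joint sufficiency holds with no smuggled gap — `DualPair → X` is the lead's kernel-checked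
  `floorCertificateEnsembleCeiling_of_dualPair` (strong duality at each `ν`, all its inputs landed), and C is
  NECESSARY (`dualPair_of_target`, weak duality). So C is not misstated relative to X.
* `line-costume` (information, not a complaint): by those two theorems C ⟺ X; the line therefore does not split the
  crux, it renames it — every attack on C is an attack on X and vice versa; the lead's STATUS-c1 says the same.
* `line-unbuilt`: §0 — `Lines/Sketch.lean` and stubs A/D/E/G/T1 import the broken `WeakDuality` chain; repairs
  p108404/p108405 filed; my four `Negative/` modules give a building import base for T2/T3/E-type content
  (`Negative.EnsemblePinch.budget_le_ensembleDissipation` = stub A over FMRT statistics,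
  `Negative.EnsemblePinch.taxed_steady_pinch` = stub E, `taxed_ensemble_pinch` ⊇ T3's content).
* `species-constraint` (LANDED, new): `Negative.EnsemblePinch.taxedCertificate_constants` — EVERY taxed certificate
  at any `ν > 0` has `4κε₁ ≤ ‖f‖₂²` (Leray–Temam steady state: `ε₁ + κ|u|² ≤ (u,f) ≤ |u|‖f‖₂`). With the line's
  ceiling `E = (‖f‖₂/κ)²` this reads `ε₁ ≤ ‖f‖₂ √E / 4`: the species can certify at most a QUARTER of the laminar
  power at its own ceiling energy, whereas X's dual only demands `ε₀ ≤ ‖f‖₂√E` (§C). Not a kill; a calibration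
  the κ-census should carry (f₁₂₃: κ_eff ≈ 0.6–1.9, ε ≈ 0.4–0.8, ‖f‖₂² = 3/2 ⇒ 4κε ≈ 1–6 ≳ 3/2 on the ATTRACTOR —
  i.e. the attractor's own (ε, κ_eff) pair is NOT certifiable as (ε₁, κ); any taxed certificate for f₁₂₃ must have
  4κε₁ ≤ 1.5, e.g. κ ≤ 0.5 at ε₁ = 0.75).
* `surplus-of-method`: a taxed certificate pins EVERY RELAXED statistic (`ε ≥ ε₁ + κe`, hence a RELAXED ceiling
  `e ≤ (‖f‖₂/κ)²` by the global energy inequality + Cauchy–Schwarz — the lead's `floor_and_ceiling_of_pinning`),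
  while C(ii) asks a ceiling only on FMRT statistics. So `TaxedCertificate` is STRICTLY stronger than C exactly by
  (relaxed ceiling) vs (FMRT ceiling) — the same relaxed ⊋ FMRT gap as §H R2, now on the ceiling side too. Exposure:
  a FAT relaxed-but-unphysical statistic of some force would kill the species without touching C; none is
  constructible today (below).
* LOAD-BEARING AXIOMS of the relaxed class in C(i): `relaxed_axioms_without_liouville_at_rest` — the Dirac mass AT REST
  satisfies every relaxed axiom EXCEPT the Liouville identities (it is a probability measure on the ball, has zero
  enstrophy, integrable work and `ε = 0 ≤ 0 = ∫(u,f)`), and it is QUIET; so any proof of C(i) lives entirely on the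
  Liouville equation (1.30) (tested at rest: `(f, Φ'(0)) = 0` for all `Φ` is false — `Φ' = f` near `0`). The other
  axioms have no cheap quiet violator: finitely supported Liouville-stationary measures sit on steady states
  (`EnsembleCeiling/Negative/DiracAtoms`), which satisfy the energy EQUALITY; Dirac masses at rescaled or
  other-viscosity steady states are not Liouville-stationary (`⟨F_ν(u'),w⟩ = (ν'−ν)(∇u',∇w) ≠ 0`); Galerkin invariant
  measures violate Liouville for test fields in the band `(N, 2N]`. An exotic quiet RELAXED statistic must carry a
  positive anomalous flux in its enstrophy tail (`∫ |u|^{1/2}‖∇u‖^{5/2} dμ = ∞`, else Liouville with `Φ = ψ(|P_m u|²)`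
  passes to the limit and gives the energy EQUALITY, since `b(u,u,u) = 0` on `H¹(T³)`): beyond every construction in
  print (convex integration does not reach `L²_t H¹_x`). Recorded as the precise shape of the R2 risk; dormant.
-/

/-- (LOCAL COPY of `Negative.RelaxedAxioms.relaxed_axioms_without_liouville_at_rest`) **The relaxed axioms minus
Liouville hold at rest, quietly**, for every force `f ∈ L²` and `ν > 0`. -/
theorem relaxed_axioms_without_liouville_at_rest {ν : ℝ} (hν : 0 < ν) (f : Vec3) :
    IsProbabilityMeasure (Measure.dirac (0 : H3)) ∧
      (∀ᵐ u ∂(Measure.dirac (0 : H3)), ‖u‖ ^ 2 ≤ 16 * (∫ x, ‖f x‖ ^ 2) / ν ^ 2) ∧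
      Torus.ensembleEnstrophy (Measure.dirac (0 : H3)) = 0 ∧
      Integrable (fun u : H3 => Torus.pairing (u : L2) f) (Measure.dirac (0 : H3)) ∧
      Torus.ensembleDissipation ν (Measure.dirac (0 : H3)) ≤ ∫ u, Torus.pairing (u : L2) f ∂(Measure.dirac (0 : H3)) ∧
      Torus.ensembleDissipation ν (Measure.dirac (0 : H3)) = 0 := by
  haveI : MeasurableSingletonClass H3 := OpensMeasurableSpace.toMeasurableSingletonClass
  have hcoe : (((0 : H3) : L2) : Vec3) =ᵐ[volume] (0 : Vec3) := by
    have h1 : ((0 : H3) : L2) = 0 := rfl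
    rw [h1]
    exact Lp.coeFn_zero _ _ _
  have hG0 : Torus.eGradNormSq (((0 : H3) : L2) : Vec3) = 0 := by
    rw [Torus.eGradNormSq_congr_ae_eq hcoe]
    exact Torus.eGradNormSq_zero_fun
  have hZ : Torus.ensembleEnstrophy (Measure.dirac (0 : H3)) = 0 := by
    unfold Torus.ensembleEnstrophy
    rw [lintegral_dirac]
    exact hG0
  have hD : Torus.ensembleDissipation ν (Measure.dirac (0 : H3)) = 0 := by
    simp [Torus.ensembleDissipation, hZ]
  have hpair0 : Torus.pairing ((0 : H3) : L2) f = 0 := by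
    unfold Torus.pairing
    have : (fun x => ⟪(((0 : H3) : L2) : Vec3) x, f x⟫_ℝ) =ᵐ[volume] fun _ => (0 : ℝ) := by
      filter_upwards [hcoe] with x hx
      rw [hx]
      simp
    rw [integral_congr_ae this, integral_zero]
  refine ⟨inferInstance, ?_, hZ, Torus.integrable_dirac _ _, ?_, hD⟩
  · rw [ae_dirac_iff]
    · have h0 : (0 : ℝ) ≤ 16 * (∫ x, ‖f x‖ ^ 2) / ν ^ 2 := by positivity
      simpa using h0
    · exact measurableSet_le (continuous_norm.pow 2).measurable measurable_const
  · rw [hD, integral_dirac, hpair0]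

/-- (LOCAL COPY of `Negative.EnsemblePinch.taxed_steady_pinch`) **The taxed pinch on atoms**: under a taxed floor at
`(f, ν)` (any `θ₁`) every steady weak solution `u ∈ V` satisfies `ε₁ + κ|u|² ≤ ν‖∇u‖² = (u, f) ≤ |u| ‖f‖₂`. -/
theorem taxed_steady_pinch {ν : ℝ} (hν : 0 < ν) {f : Vec3} (hf : MemLp f 2 volume)
    {Φ₁ : Torus.CylindricalTest (Fin 3)} {θ₁ ε₁ κ : ℝ}
    (hfloor : ∀ u : H3, Torus.eGradNormSq ((u : L2) : Vec3) ≠ ⊤ → ‖u‖ ^ 2 ≤ 16 * (∫ x, ‖f x‖ ^ 2) / ν ^ 2 →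
      ε₁ + κ * ‖u‖ ^ 2 ≤ ν * (Torus.eGradNormSq ((u : L2) : Vec3)).toReal + Torus.nsGeneratorPairing ν f u (Φ₁.grad u) +
        2 * θ₁ * (Torus.pairing (u : L2) f - ν * (Torus.eGradNormSq ((u : L2) : Vec3)).toReal))
    {u : H3} (hV : (u : L2) ∈ Torus.energySpaceV (Fin 3)) (hu : Torus.IsSteadyWeakSolution ν f u) :
    ε₁ + κ * ‖u‖ ^ 2 ≤ ν * (Torus.eGradNormSq ((u : L2) : Vec3)).toReal ∧
      ν * (Torus.eGradNormSq ((u : L2) : Vec3)).toReal = Torus.pairing (u : L2) f ∧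
      Torus.pairing (u : L2) f ≤ ‖u‖ * ‖hf.toLp f‖ := by
  have hfin : Torus.eGradNormSq ((u : L2) : Vec3) ≠ ⊤ := hV.2.eGradNormSq_lt_top.ne
  have henergy : ν * (Torus.eGradNormSq ((u : L2) : Vec3)).toReal = Torus.pairing (u : L2) f :=
    Torus.IsSteadyWeakSolution.energy_eq' (by simp) hf hV hu
  have hgen : Torus.nsGeneratorPairing ν f u (Φ₁.grad u) = 0 :=
    hu _ (Torus.CylindricalTest.isSmooth_grad_holds Φ₁ u) (Torus.CylindricalTest.isDivFree_grad_holds Φ₁ u)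
      (Torus.CylindricalTest.hasZeroMean_grad_holds Φ₁ u)
  have hp : Torus.pairing (u : L2) f ≤ ‖u‖ * ‖hf.toLp f‖ := (le_abs_self _).trans (Torus.abs_pairing_coe_le hf u)
  have hball : ‖u‖ ^ 2 ≤ 16 * (∫ x, ‖f x‖ ^ 2) / ν ^ 2 := by
    refine leray_ball_of_norm_le hν hf ?_
    have hP := Torus.norm_sq_le_toReal_eGradNormSq u hfin
    rw [le_div_iff₀ (by positivity)]
    by_cases h0 : ‖u‖ = 0
    · rw [h0, zero_mul]; exact norm_nonneg _
    · have hpos : 0 < ‖u‖ := lt_of_le_of_ne (norm_nonneg _) (Ne.symm h0)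
      have : ν * (4 * Real.pi ^ 2 * ‖u‖ ^ 2) ≤ ‖u‖ * ‖hf.toLp f‖ := by nlinarith
      nlinarith
  have h := hfloor u hfin hball
  rw [hgen, ← henergy] at h
  exact ⟨by linarith, henergy, hp⟩

/-- (LOCAL COPY of `Negative.EnsemblePinch.taxedCertificate_constants`) **THE SPECIES CONSTRAINT `4κε₁ ≤ ‖f‖₂²`**: a
taxed floor with `κ ≥ 0` at some `ν > 0` forces `4κε₁ ≤ ‖f‖₂²` (Leray–Temam steady state:
`ε₁ + κ|u|² ≤ (u,f) ≤ |u|‖f‖₂ ≤ κ|u|² + ‖f‖₂²/(4κ)`). -/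
theorem taxedCertificate_constants {ν : ℝ} (hν : 0 < ν) {f : Vec3} (hf : MemLp f 2 volume)
    {Φ₁ : Torus.CylindricalTest (Fin 3)} {θ₁ ε₁ κ : ℝ} (hκ : 0 ≤ κ)
    (hfloor : ∀ u : H3, Torus.eGradNormSq ((u : L2) : Vec3) ≠ ⊤ → ‖u‖ ^ 2 ≤ 16 * (∫ x, ‖f x‖ ^ 2) / ν ^ 2 →
      ε₁ + κ * ‖u‖ ^ 2 ≤ ν * (Torus.eGradNormSq ((u : L2) : Vec3)).toReal + Torus.nsGeneratorPairing ν f u (Φ₁.grad u) +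
        2 * θ₁ * (Torus.pairing (u : L2) f - ν * (Torus.eGradNormSq ((u : L2) : Vec3)).toReal)) :
    4 * κ * ε₁ ≤ ∫ x, ‖f x‖ ^ 2 := by
  obtain ⟨u, hV, hu⟩ := Torus.Temam1979_exists_steadyWeakSolution_holds (by simp) hν hf
  obtain ⟨h1, h2, h3⟩ := taxed_steady_pinch hν hf hfloor hV hu
  have hF : ‖hf.toLp f‖ ^ 2 = ∫ x, ‖f x‖ ^ 2 := by
    rw [Torus.norm_toLp_eq_sqrt hf, Real.sq_sqrt (integral_nonneg fun x => by positivity)]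
  have h : ε₁ + κ * ‖u‖ ^ 2 ≤ ‖u‖ * ‖hf.toLp f‖ := by linarith
  have h4 : κ * (ε₁ + κ * ‖u‖ ^ 2) ≤ κ * (‖u‖ * ‖hf.toLp f‖) := mul_le_mul_of_nonneg_left h hκ
  rw [← hF]
  nlinarith [sq_nonneg (‖hf.toLp f‖ - 2 * κ * ‖u‖)]

/-- **Taxed ⇒ the pair, with the species' constants** (the lead's `floorCertificateEnsembleCeiling_of_taxed` at one
force and one viscosity, here over the building import base): a taxed floor at `(f, ν)` with `κ > 0`, `ε₁ ≥ 0`,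
`θ₁ ≤ 0` gives `PairAt f ε₁ ((‖f‖₂/κ)²) ν`. -/
theorem pairAt_of_taxed {ν : ℝ} (hν : 0 < ν) {f : Vec3} (hf : MemLp f 2 volume) {Φ₁ : Torus.CylindricalTest (Fin 3)}
    {θ₁ ε₁ κ : ℝ} (hθ₁ : θ₁ ≤ 0) (hε₁ : 0 ≤ ε₁) (hκ : 0 < κ)
    (hfloor : ∀ u : H3, Torus.eGradNormSq ((u : L2) : Vec3) ≠ ⊤ → ‖u‖ ^ 2 ≤ 16 * (∫ x, ‖f x‖ ^ 2) / ν ^ 2 →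
      ε₁ + κ * ‖u‖ ^ 2 ≤ ν * (Torus.eGradNormSq ((u : L2) : Vec3)).toReal + Torus.nsGeneratorPairing ν f u (Φ₁.grad u) +
        2 * θ₁ * (Torus.pairing (u : L2) f - ν * (Torus.eGradNormSq ((u : L2) : Vec3)).toReal)) :
    PairAt f ε₁ ((Real.sqrt (∫ x, ‖f x‖ ^ 2) / κ) ^ 2) ν := by
  refine ⟨⟨Φ₁, θ₁, hθ₁, fun u hfin hball => ?_⟩, fun μ hμ hint => ?_⟩
  · have h := hfloor u hfin hball
    nlinarith [mul_nonneg hκ.le (sq_nonneg ‖u‖)]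
  · haveI := hμ.prob
    have hg : Integrable (fun u : H3 => ε₁ + κ * ‖u‖ ^ 2) μ := (integrable_const ε₁).add (hint.const_mul κ)
    have hA := budget_le_ensembleDissipation hν hf hθ₁ (g := fun u : H3 => ε₁ + κ * ‖u‖ ^ 2) hfloor hμ hg
    have hsplit : ∫ u : H3, (ε₁ + κ * ‖u‖ ^ 2) ∂μ = ε₁ + κ * Torus.ensembleEnergy μ := by
      rw [integral_add (integrable_const ε₁) (hint.const_mul κ), integral_const_mul]
      simp [Torus.ensembleEnergy]
    rw [hsplit] at hA
    have hI := Torus.ensembleDissipation_le_of_isStationary_holds hμ hf hint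
    have he0 : 0 ≤ Torus.ensembleEnergy μ := integral_nonneg fun u => by positivity
    set a : ℝ := Real.sqrt (Torus.ensembleEnergy μ) with ha
    have ha0 : 0 ≤ a := Real.sqrt_nonneg _
    have ha2 : a ^ 2 = Torus.ensembleEnergy μ := Real.sq_sqrt he0
    have hF0 : 0 ≤ Real.sqrt (∫ x, ‖f x‖ ^ 2) := Real.sqrt_nonneg _
    have hk : κ * a ^ 2 ≤ Real.sqrt (∫ x, ‖f x‖ ^ 2) * a := by rw [ha2]; linarith
    have hle : a ≤ Real.sqrt (∫ x, ‖f x‖ ^ 2) / κ := by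
      rw [le_div_iff₀ hκ]
      rcases eq_or_lt_of_le ha0 with h0 | hpos
      · rw [← h0]; simp
      · nlinarith
    rw [← ha2]
    exact pow_le_pow_left₀ ha0 hle 2

/-! ## §J Numerics on the line's witness force (g2: kit j018108 and g3: kit j020045 reported only to their own seats; g4: kit j020246 `steady123-g4b` — queued at v8 publication (pool saturated, p95 wait ≈ 5.6 h); its table is appended at the END of this section by the next publication)

Newton–Krylov continuation in `ν` (0.04 → 0.001, ratio 0.8) of the from-rest STEADY branch of `NS_ν(f)` on
`T³ = [0,1)³` for `f₁₂₃ = (sin 2πz, sin 4πx, sin 6πy)` (the line's live witness force; TRIAGE-r1-2 recommendation 4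
named it the disprover's target) and the control `f_GP = (sin 2πz, sin 2πx, sin 2πy)`; pseudo-spectral Galerkin
`N = 32, 48` (2/3 dealiased), rotational form, GMRES with Stokes preconditioner, backtracking Newton; per `ν`:
`U² = ∫|u|²`, `ε = ν‖∇u‖²`, `(f,u)` (= ε at a steady state), component energies, spectral tail, Newton/GMRES counts
and a crude leading growth rate from a short perturbed IF-RK4 run. READING RULE: along ANY steady branch `u_ν` the
Dirac masses are stationary statistical solutions, so `ε(u_ν) → 0` (quiet) or `U²(u_ν) → ∞` (fat; warm `ν^{-2/3}` or
laminar `ν^{-2}`) kills `X` AT THAT FORCE (§E); `ε ≍ 1` and `U² ≍ 1` down the branch is consistent with `X(f₁₂₃)`.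
Known before this job (TRIAGE-r1-2 §Census, kit j014255; EnsembleCeiling TRIAGE-r1-1 §N2): on the ATTRACTORS met by DNS
for `ν ∈ [0.0035, 0.04]`, `ε ∈ [0.40, 0.83]`, `U² ∈ [0.21, 1.13]` (loud and saturated); the unstable steady branch
below `ν = 0.005` was undecided. Results are appended here by the next publication of this file.

FAT-BRANCH ANSATZ TEST (paper, this seat; why a LAMINAR-TYPE fat branch is not expected for `f₁₂₃` while it exists for
`f_GP`). A steady branch with `U = |u_ν| → ∞` must, after rescaling `u = U v`, `|v| = 1`, satisfy
`B(v,v) = (f − νU A v)/U² → 0`: its skeleton `v₀` is a unit-energy STEADY EULER flow, and at the laminar rate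
`U = c/ν`, writing `u = U v₀ + w₀ + w₁/U + …`, the orders `U¹, U⁰` read `L_{v₀} w₀ = 0` and
`L_{v₀} w₁ = f − c A v₀ − B(w₀,w₀)` with `L_{v₀} w = B(v₀,w) + B(w,v₀)` the linearised steady Euler operator — so
`f − cAv₀ − B(w₀,w₀) ∈ Range L_{v₀}` for some `w₀ ∈ Ker L_{v₀}` is the leading-order COMPATIBILITY CONDITION of a
smooth fat branch with skeleton `v₀` (cokernel vectors `ψ` of `L_{v₀}` test it: `⟨f − cAv₀ − B(w₀,w₀), ψ⟩ = 0`). (i) `f_GP`: `v₀ = h₊` (the `+`-helical Beltrami part of the force shell) is steady Euler AND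
an `A`-eigenfunction, `cAh₊` cancels the `h₊`-component of `f_GP` exactly, and the remainder is absorbed order by order
(the resolved branch `u = h₊/(4π²ν) + O(ν)` of EnsembleCeiling TRIAGE-r1-1 §N1). (ii) `f₁₂₃ = (sin 2πz, sin 4πx, sin 6πy)`:
the Euler-steady `A`-eigen-skeletons inside the force are the three jets `sin 2πz e₁`, `sin 4πx e₂`, `sin 6πy e₃`
(x-, y-, z-independent unidirectional flows). For the x-jet `v₀ = sin 2πz e₁` (`c = 1/4π²` cancels `f₁`), average the
`e₂,e₃`-components of `L_{v₀} w + ∇q = f − cAv₀ = (0, sin 4πx, sin 6πy)` over `x`: the transport `sin 2πz ∂ₓw`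
drops, the coupling `(w·∇)v₀ = 2π w₃ cos 2πz e₁` has no `e₂,e₃` part, so `∇_{(y,z)} q̄ = (0, sin 6πy)ᵀ`-mean, i.e.
`∂_y q̄ = 0`, `∂_z q̄ = sin 6πy` — not a gradient: OBSTRUCTED (cokernel vector `ψ = sin 6πy e₃`: x-independent, div-free,
`ψ₁ = 0`, so `ψ ⊥ Range L_{v₀}` identically, while `⟨f, ψ⟩ = ½`; the kernel corrections `w₀ = (W(y,z), V(z), 0)` have
`B(w₀,w₀) ⊥ ψ` too). The y-jet is obstructed by `ψ = sin 2πz e₁`, the z-jet by `ψ = sin 4πx e₂`. The single-mode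
BELTRAMI skeleton `h₊ = (sin 2πz, cos 2πz, 0)` (cancelling the `+`-helical half of `f₁ e₁ = ½(h₊ + h₋)` with
`u ≈ h₊/(8π²ν)`) is obstructed by Fourier support: `Range L_{h₊}` has NO `(0,0,±1)` modes (they would need `w` at
`(0,0,0)` or `(0,0,±2)`, and z-only fields lie in `Ker L_{h₊}`), and `B(w₀,w₀) = 0` on the kernel pieces (z-shears,
same-helicity shell-1 Beltrami fields), so the `−`-helical half `½h₋` of the same force mode cannot be absorbed —
unlike `f_GP`, whose ABC skeleton `H₊` couples all three unit wavevectors so that `Range L_{H₊}` reaches the force shell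
(its resolved halo). So NO jet- or single-Beltrami-skeleton laminar-rate fat branch of `NS_ν(f₁₂₃)` exists at leading
order — the cyclic design "each component is advected by the next" (the e_i-moat criterion of card
`cyclic-livsic-moats`) is exactly the jet obstruction. What the test does NOT exclude: (a) 2½-D skeletons `v₀ = S(y,z)e₁`
with kernel corrections `(W, ∇^⊥G(S))`, whose next order `S ∂ₓ w = …` is singular on the zero set of `S` — CRITICAL
LAYERS, i.e. the WARM streaming branch `U ≍ ν^{-1/3}`, energy `ν^{-2/3} → ∞`, dissipation `ν^{1/3} → 0` of the crux
NOTES (ideator 3, note (1)), which would kill BOTH halves of `X` at `f₁₂₃`; (b) skeletons outside the force shell reached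
through folds; (c) QUIET branches. Hence the Newton continuation of the O(1) from-rest branch (§J job: `U² ≍ ν^{-2/3}`
would grow by a factor ≈ 12 between `ν = 0.04` and `0.001`, `ε ≍ ν^{1/3}` would drop by ≈ 3.4) plus its fold structure is
the decisive cheap experiment.
-/

/-! ## §K (v7) New necessary conditions on the witness force, read on the §A vocabulary

The three generation-3 files are imported above; here are their readers on `TargetAt` / `FloorAt` (definitional
unfoldings, so that ideators and planners can cite them in the vocabulary of this file). -/

/-- §K.1 **The floor digs a moat** (`Negative.floor_moat` read on `FloorAt`): under X's floor at `(f, ν)` every steady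
weak solution `u ∈ V` of `NS_ν(f)` is `ε₀/‖f‖₂`-far in `L²` from every finite-enstrophy steady weak Euler solution
`U` of `f`. -/
theorem floorAt_moat {ν : ℝ} (hν : 0 < ν) {f : Vec3} (hf : MemLp f 2 volume) {ε₀ : ℝ} (hfloor : FloorAt f ε₀ ν)
    {u : H3} (huV : (u : L2) ∈ Torus.energySpaceV (Fin 3)) (hu : Torus.IsSteadyWeakSolution ν f u)
    {U : H3} (hUV : (U : L2) ∈ Torus.energySpaceV (Fin 3)) (hU : Torus.IsSteadyWeakSolution 0 f U) :
    ε₀ ≤ ‖hf.toLp f‖ * ‖u - U‖ := by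
  obtain ⟨Φ₁, θ₁, -, h⟩ := hfloor
  exact Summit.AnomalousDissipation.AnomalousDissipation.Theorems.FloorCertificateEnsembleCeiling.Negative.floor_moat
    hν hf h huV hu hUV hU

/-- §K.1 **Tame approach kills the target at its force** (`Negative.xBody_false_of_tameApproach` on `TargetAt`):
if at arbitrarily small `ν` some steady state of `NS_ν(f)` is arbitrarily `L²`-close to some finite-enstrophy steady
weak Euler solution of `f`, then `¬ TargetAt f`. -/
theorem not_targetAt_of_tameApproach {f : Vec3} (hf : MemLp f 2 volume)
    (happ : ∀ δ ν₀ : ℝ, 0 < δ → 0 < ν₀ → ∃ ν : ℝ, 0 < ν ∧ ν < ν₀ ∧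
      ∃ u : H3, (u : L2) ∈ Torus.energySpaceV (Fin 3) ∧ Torus.IsSteadyWeakSolution ν f u ∧
        ∃ U : H3, (U : L2) ∈ Torus.energySpaceV (Fin 3) ∧ Torus.IsSteadyWeakSolution 0 f U ∧ ‖u - U‖ < δ) :
    ¬ TargetAt f :=
  Summit.AnomalousDissipation.AnomalousDissipation.Theorems.FloorCertificateEnsembleCeiling.Negative.xBody_false_of_tameApproach
    hf happ

/-- §K.1 **Tame `L²`-limits of steady states kill the target at its force** (`Negative.xBody_false_of_tameLimit`):
steady states `u_n ∈ V` of `NS_{ν_n}(f)`, `ν_n → 0⁺`, converging in `L²` to a FINITE-ENSTROPHY field `U` ⇒ `¬ TargetAt f`.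
READING RULE for §J: a loud (`ν‖∇u_ν‖² ≥ ε₀`) steady branch cannot converge in `L²` to an `H¹` profile. -/
theorem not_targetAt_of_tameLimit {f : Vec3} (hf : MemLp f 2 volume) {ν : ℕ → ℝ} {u : ℕ → H3} {U : H3}
    (hνpos : ∀ n, 0 < ν n) (hν : Tendsto ν atTop (𝓝 0))
    (huV : ∀ n, ((u n : H3) : L2) ∈ Torus.energySpaceV (Fin 3)) (hu : ∀ n, Torus.IsSteadyWeakSolution (ν n) f (u n))
    (hUV : (U : L2) ∈ Torus.energySpaceV (Fin 3)) (hlim : Tendsto u atTop (𝓝 U)) : ¬ TargetAt f :=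
  Summit.AnomalousDissipation.AnomalousDissipation.Theorems.FloorCertificateEnsembleCeiling.Negative.xBody_false_of_tameLimit
    hf hνpos hν huV hu hUV hlim

/-- §K.2 **The target fails at the Laplacian of every non-trivial Euler-steady profile**
(`Negative.xBody_false_of_eulerSteady_laplacianPreimage` on `TargetAt`; abstract Marchioro barrier: `U/ν` is an exact
laminar steady family of `NS_ν(−ΔU)`, energy `‖U‖₂²/ν²`). -/
theorem not_targetAt_laplacian_of_eulerSteady {U : Vec3} (hUs : Torus.IsSmooth U) (hUd : Torus.IsDivFree U)
    (hUz : Torus.HasZeroMean U)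
    (hI : ∀ w : Vec3, Torus.IsSmooth w → Torus.IsDivFree w → Torus.HasZeroMean w →
      ∫ x, ⟪Torus.fderiv w x (U x), U x⟫_ℝ = 0)
    (hU0 : 0 < ∫ x, ‖U x‖ ^ 2) : ¬ TargetAt (fun x => -Torus.laplacian U x) :=
  Summit.AnomalousDissipation.AnomalousDissipation.Theorems.FloorCertificateEnsembleCeiling.Negative.xBody_false_of_eulerSteady_laplacianPreimage
    hUs hUd hUz hI hU0

/-- §F completed (v7; `SingleModeFat` builds again): **single-mode forces are not witnesses** (`not_ceiling_of_singleMode`). -/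
theorem not_targetAt_singleMode {k : Fin 3 → ℤ} {z : EuclideanSpace ℂ (Fin 3)} (hk : k ≠ 0)
    (hz : ((fun j => ((k j : ℂ))) ⬝ᵥ (WithLp.ofLp z)) = 0) (hz0 : z ≠ 0) :
    ¬ TargetAt (Torus.realTrigPoly {k} (fun _ => z)) :=
  not_targetAt_of_not_ceiling (not_ceiling_of_singleMode hk hz hz0)

/-- §F completed (v7): **`X` with `∃ f` replaced by `∀ f ≠ 0` is false** — the Kolmogorov single-mode force has no
ceiling (`not_forall_forces_ensembleCeiling`). -/
theorem not_forall_forces_target :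
    ¬ ∀ f : Vec3, Torus.IsSmooth f → Torus.IsDivFree f → Torus.HasZeroMean f → 0 < (∫ x, ‖f x‖ ^ 2) → TargetAt f := by
  intro h
  refine not_forall_forces_ensembleCeiling fun f hfs hfd hfz hF => ?_
  obtain ⟨ε₀, E, ν₀, -, hν₀, hp⟩ := h f hfs hfd hfz hF
  exact ⟨E, ν₀, hν₀, fun ν hν hνν₀ => (hp ν hν hνν₀).2⟩

/-! ### §K.3 The finite-enstrophy guard is load-bearing — UNCONDITIONAL since v8
(`Negative/FormalGuards.lean` p126933, imported; `Negative/RoughStates.lean` p127512, landed)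

`floorWithoutGuard_false_at_rough_states` (g3): the unguarded floor (`ε₀ > 0`, `θ₁ ≤ 0`, `ν > 0`, `f ∈ L²`) forces
`Torus.eGradNormSq r ≠ ⊤` for EVERY `r ∈ H`; `floorCertificateEnsembleCeiling_withoutGuard_forces_finite_enstrophy`:
`X` with the guard deleted ⇒ `H = V`. NEW (g4, `RoughStates`): `exists_rough_energySpace : ∃ r : H, eGradNormSq r = ⊤`
(the lacunary shear `u = (0, ∑ₙ 2·4^{-(n+1)} cos(2π4^{n+1}x₀), 0)`: `∑‖û‖ < ∞` so `u` is continuous, while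
`|k|²‖û(k)‖² = 1` on the support), `exists_energySpace_not_mem_energySpaceV` (`H ≠ V`), and the composition
`floorCertificateEnsembleCeiling_false_without_guard : ¬(X without the guard)`. So the guard is load-bearing in the strict
sense: deleting it makes `X` refutable by ONE explicit state (at which `ν·(⊤).toReal = 0` turns the certificate
inequality into `ε₀ ≤ ⟨F(u),Φ₁'(u)⟩ + 2θ₁(u,f)`, killed near Temam's steady state). Re-exported below on the imported g3
half; the g4 half is cited by name until the farm has built the module. -/

/-- §K.3 (imported form of the g3 engine, `Negative.floorWithoutGuard_false_at_rough_states`, read at this file's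
vocabulary): an UNGUARDED floor at `(f, ν)` — X's floor inequality demanded at every state of the Leray ball, rough or
not — leaves no room for a rough state: every `r ∈ H` then has finite enstrophy. Combine with
`Negative.exists_rough_energySpace` (p127512) for the contradiction. -/
theorem floorWithoutGuard_forces_finite_enstrophy {ν : ℝ} (hν : 0 < ν) {f : Vec3} (hf : MemLp f 2 volume) {ε₀ : ℝ}
    (hε₀ : 0 < ε₀) {Φ₁ : Torus.CylindricalTest (Fin 3)} {θ₁ : ℝ} (hθ₁ : θ₁ ≤ 0)
    (hfloor : ∀ u : H3, ‖u‖ ^ 2 ≤ 16 * (∫ x, ‖f x‖ ^ 2) / ν ^ 2 →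
      ε₀ ≤ ν * (Torus.eGradNormSq ((u : L2) : Vec3)).toReal + Torus.nsGeneratorPairing ν f u (Φ₁.grad u) +
        2 * θ₁ * (Torus.pairing (u : L2) f - ν * (Torus.eGradNormSq ((u : L2) : Vec3)).toReal))
    (r : H3) : Torus.eGradNormSq ((r : L2) : Vec3) ≠ ⊤ :=
  Summit.AnomalousDissipation.AnomalousDissipation.Theorems.FloorCertificateEnsembleCeiling.Negative.floorWithoutGuard_false_at_rough_states
    hν hf hε₀ hθ₁ hfloor r

/-! ## §L (v7) Gaps — what no landed lemma excludes yet (for planners pinning a force)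

(1) **2½-D forces** `f = (f₁, f₂, f₃)(x₁, x₂)` with `f₃ ≠ 0` (`IsPlanarForce` of `KolmogorovFloorEnsembleCeiling/
Negative/PlanarForces` requires `f₃ = 0`; the orthogonal class requires finitely many modes all orthogonal to all
amplitudes; §K.2 requires `A⁻¹f` Euler-steady). The `x₃`-invariant steady states are `u = (v, w)(x₁,x₂)` with `v` the
planar steady NS flow of `(f₁,f₂)` (squeezed: `(ν‖∇v‖²)² ≤ ν‖Δ(f₁,f₂)‖₂|v|³`, `Planar.dissipation_sq_le_of_residual_gradient`)
and `w` the steady PASSIVE SCALAR `v·∇w = νΔw + f₃`. The scalar has no 2-D squeeze (`(v·∇w, Δw) = −∫∇w·S∇w ≠ 0`: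
scalar-gradient stretching exists in 2-D), so "quiet or fat" for `w` is the inviscid limit of steady
advection–diffusion in a bounded-energy cellular/shear flow: FAT (`w ≍ ν⁻¹ × streamline means of f₃`, flux expulsion)
when some streamline average of `f₃` is non-zero, QUIET (`χ = (f₃,w) → (f₃,w₀) = (v₀·∇w₀, w₀) = 0` when the cell
problems are solvable; boundary layers `≍ ν^{1/2}`, Childress 1979 / Shraiman 1987 scaling `χ ≍ ν^{1/2}`) otherwise —
a THEOREM only force by force. Planners: a 2½-D force is NOT a safe witness (heuristically dead), but it is not
excluded by the tree; the cheapest kernel target is `f = (g(x₂), 0, h(x₁,x₂))`-type shear-plus-scalar forces where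
the cell problem is explicit.
(2) **Planarity along other axes / lattice directions**: `IsPlanarForce` fixes the third axis; every statement of the
route is covariant under the 48 lattice isometries of `T³` (coordinate permutations and reflections act on `H`, `V`,
cylindrical tests, `IsStationaryStatisticalSolution` by push-forward), but the covariance is not formalised — a force
invariant along `e₁` or `e₂` (or along `(1,1,0)`, after the corresponding `SL₃(ℤ)` change of lattice basis, which
changes the metric and hence is NOT an isometry: only the permutation/reflection group is free) is excluded on paper
only.
(3) RESOLVED at v8: the named rough element of `H` is `Negative.RoughStates.exists_rough_energySpace` (p127512) and
§K.3 is unconditional (`floorCertificateEnsembleCeiling_false_without_guard`).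
(4) **The relaxed ⊋ FMRT exposure R2** (v5/v6 §I): unchanged, dormant.
(5) (g4) **The exact missing lemma for (1)**: for the shear-plus-scalar forces `f = (g(x₂), 0, h(x₁,x₂))` (`g, h` smooth
mean-zero, `∂₁h ≠ 0` so that the Stokes preimage `(G, 0, H)` is NOT Euler-steady and §K.2 does not apply) the FAT steady
state is `u_ν = (G(x₂)/ν, 0, w_ν)` with `−G'' = g` and `w_ν` THE solution of the steady advection–diffusion problem
`(G/ν)∂₁w − νΔw = h` on `T²`; its energy is `≥ ‖G‖₂²/ν²`, its Dirac mass a stationary statistical solution, so the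
ceiling and `X` die at every such `f` — GIVEN the existence (Lax–Milgram in mean-zero `H¹(T²)`: the form
`ν(∇w,∇φ) + ((G/ν)∂₁w, φ)` is coercive since the drift is solenoidal) and `H¹`-regularity of `w_ν` (to place `u_ν` in `V`
and verify `IsSteadyWeakSolution`). The tree has Lax–Milgram developments elsewhere (`ElgindiEllipticWeakExistence`,
`GaussianVortexFormDomain`) but no steady advection–diffusion solver on the torus; no explicit solution exists (the formal
`ν`-expansion `w = νW₁ + ν³W₃ + …` needs `G∂₁W₃ = ΔW₁`, singular at the zeros of the mean-zero profile `G` — the critical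
layers of width `ν^{2/3}` are genuine). Estimated ≥ 800 lines; parked as the cheapest OPEN kernel target of this file
(value: first exclusion of a force class whose Stokes preimage is not Euler-steady — "fat by an autonomous laminar
sub-system").
-/

/-! ## §H Why the crux resists (updated v7; no claim)

A refutation of `X` must produce, for EVERY smooth solenoidal mean-zero `f ≠ 0` that is genuinely three-dimensional
and outside the Euler-steady laminar classes of §F, and for every box `(ε₀, E)`, a stationary statistical solution of
`NS_ν(f)` at arbitrarily small `ν` which is quiet or fat (§E) — i.e. decide the ensemble zeroth law with saturation
AGAINST every candidate force. Known adversaries and why they stop short (v5, unchanged): kinematic beats/baths/packets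
refute only BAND-LIMITED or ν-UNIFORM certificates; smooth quiet Euler points cost the certifier `1/ν`, affordable in
the unrestricted class; laminar fat branches need an Euler-steady Stokes preimage; planar forces die by the
Alexakis–Doering dichotomy (quiet OR fat 2-D condensate), which needs `x₃`-invariance. New in v6: (1) all necessary
conditions are landed, so any future kill needs only to exhibit its quiet-or-fat object and call
`Negative.target_false_of_quietOrFat*`/`not_pair_of_quietOrFat_steady`; (2) the picked line neither lowers nor
raises the bar (C ⟺ X), but its METHOD is calibrated: `4κε₁ ≤ ‖f‖₂²`; (3) the relaxed-class exposure (R2) is now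
stated on both sides (floor: quiet exotic relaxed statistic; species: fat exotic relaxed statistic) with the precise
analytic signature such an object must have (anomalous flux carried by the enstrophy tail); by the superposition
principle for continuity equations a relaxed statistic is carried by global distributional solutions of NS in the
Leray ball with `∫‖∇u‖² dμ < ∞`, i.e. by `L^∞_t L²_x ∩ L²_t H¹_x` weak solutions WITHOUT energy inequality — whether such
solutions can violate the energy inequality is the open energy-equality/selection problem for that class (convex
integration does not reach `L²_t H¹_x`), so R2 is dormant for a reason; (4) the only live numerical threat to the
line's witness force is an unstable warm/fat steady branch of `NS_ν(f₁₂₃)` below `ν = 0.005` (§J); for SHEAR-CLASS forces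
such unstable fat equilibria are documented (3-D Kolmogorov flow: an edge-state equilibrium with upper/lower branches born
in a saddle-node at finite `Re`, i.e. energies `≍ ν⁻²` in the present units — van Veen–Goto, arXiv:1512.02570; plane
Couette/Poiseuille exact coherent structures, Waleffe), and a branch of that kind for `f₁₂₃`, disconnected from the
from-rest branch, would escape the §J continuation — the caveat of every branch-following experiment. `X` is believed TRUE for generic `f` and unprovable today; cheap handles
(`f = 0`, constants, vacuity, junk values, large `ν`) are exhausted and landed. New in v7: (5) the steady-state side
of any refutation AT A FORCE now has three kernel-checked entrances — FAT family, QUIET family (`KillShapes`) and TAME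
APPROACH (`TameLimits`: steady states `L²`-approaching finite-enstrophy steady Euler solutions, e.g. the quiet point
`v` of a designer force `f_v = P[(v·∇)v]` if its viscous continuation `u_ν → v` exists in `L²` — the open part being
exactly that continuation); (6) on the positive side, §K.1 pins the only scenario compatible with `X(f)`: loud bounded
steady states that become ROUGH in the limit (no finite-enstrophy `L²` accumulation point) — K41-type roughness of
STEADY solutions of a fixed smooth force, for which no mechanism is known (steady inviscid limits of record are
Prandtl–Batchelor / vortex-sheet / Beltrami selections, all quiet or fat); this is the sharpest form of the doubt
about `X` — and about the route's deciding crux #3 — that this seat can state as theorems today. New in v8: (7)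
LITERATURE WATCH 2026 (S2 sweep "anomalous dissipation Navier–Stokes forcing", 2023–2026, 25 rows): the positive
fixed-geometry constructions remain of Bruè–De Lellis type with `ν`-DEPENDENT forces (arXiv:2605.18126, structural
stability of the BDL construction in the 2½-D framework; arXiv:2307.06812, `d`-dimensional version) and the negative
results are two-dimensional or boundary-driven (arXiv:2403.04668 no anomalous dissipation in 2-D; arXiv:2504.18523 vortex
sheets; arXiv:2509.12432 Navier boundary conditions; arXiv:2606.04218 local 2-D balance): nothing in print decides, for a
FIXED smooth force on `T³`, whether stationary statistics can be quiet or fat — `X` and `¬X` stay research-open; (8) the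
formal anatomy of `X` is now complete (§K.3 unconditional), so every further negative lemma about `X` must be about a
FORCE CLASS (§F/§K.2/§L) or about the pinned force's branch structure (§J).
-/

/-! ## §M (v8) Generation-4 attack log — what was tried beyond v7, with outcomes (for the next disprover)

1. ROUGH STATES (done, landed p127512): see §K.3. Device worth remembering: `exists_energySpace_of_coeff` — membership in
   `H` of a synthesised field is cheapest through the LERAY PROJECTOR (`P v = v` coefficientwise by `lerayCoeff` on
   transversal families), not through weak divergence-freeness.
2. 2½-D SHEAR + SCALAR forces `(g(x₂), 0, h(x₁,x₂))` (parked): §L(5) — fat laminar sub-system, needs the steady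
   advection–diffusion solver on `T²`; the first force class with NON-Euler-steady Stokes preimage that would be excluded.
3. WEAK-LIMIT FORM OF THE MOAT (observation, no new theorem needed): at a steady state `ε(u) = ν‖∇u‖² = (u, f)` is an
   AFFINE WEAKLY CONTINUOUS functional of the state, so (i) quietness of a steady family is decided by its weak `L²` limit
   points `U` alone: `ε(u_ν) → (U, f)`; (ii) under `X(f)` every weak limit point of steady states as `ν → 0` lies in the
   slab `(U, f) ≥ ε₀`, `‖U‖² ≤ E` — in particular steady states cannot converge weakly to `0`, to any field orthogonal to
   `f`, or to any finite-enstrophy steady weak Euler solution of `f` (for which `(U,f) = 0`; this is `TameLimits` with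
   strong convergence weakened to weak convergence PLUS the limit being Euler-steady, which strong convergence gave for
   free). Reading rule for §J unchanged: watch `work = (u,f)`.
4. GUARD MUTATIONS re-derived on paper (no lemma filed, by design): `θ₁ ≤ 0` dropped — `X` still implies #3
   (`TargetImpliesSteady` uses no sign) and is implied by nothing cheaper: no violator either way; the Leray-ball
   restriction dropped — affordable for the certifier (`|θ₁| ≍ 1/ν` prices the far field by amplified Poincaré
   dissipation): not load-bearing for falsity; `0 < ν` dropped — false by junk (at `ν = −1` the "dissipation" is
   `−‖∇u‖²`, unbounded below on the ball at fixed energy, while the tested generator is bounded on the ball for a fixed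
   cylindrical `Φ₁`) — junk anatomy of no use to provers, not filed.
5. NUMERICS: §J (kit j020246). The decisive cheap experiment of v6 §J, to be reported into this file (v9).
6. NOT REDONE (settled by earlier generations, see §H): literature kill (none), definition slack (four audits: none),
   `f = 0` / large `ν` / constants / `∀ f` / uniform-in-`ν` certificate (all landed: §D, §G, and for the floor half the
   sibling files `FloorCertificate/Negative/{Uniform,FixedMultiplier,FixedResolution}` — the certificate MUST sharpen with
   `ν`: one `(Φ₁, θ₁)` for all `ν < ν₀` is refuted for every force by the frozen-multiplier beat, `not_floorCertificateUniform`).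
-/

end Summit.AnomalousDissipation.AnomalousDissipation.Cruxes.FloorCertificateEnsembleCeiling.Disproof

end
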